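import Literature.AnabelianGeometry.SemiGraphs.TemperedFibreProduct
import Literature.AnabelianGeometry.SemiGraphs.ProfiniteCompletionEta
import Mathlib.Tactic.Group
import HarnessLib

/-!
# The fibre product `Γ = P ×_Z ℤ`, part B: the dense discrete subgroup, fibrewise density, and
# `pr₁ : Γ → P` IS the profinite completion — [SemiAnbd] Prop. 3.6 (iii) / §6 p. 69 shape

Mochizuki, *Semi-graphs of anabelioids*, Publ. RIMS **42** (2006) [SemiAnbd], Prop. 3.6 (iii) p. 38
("`π₁^temp ↪ π̂₁`"), §6 p. 69 ("the profinite completion `∧`"); [EtTh] §1 p. 12 ("`Π_X := (Π^tp_X)^∧`").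
abc-iut cell, wave-5 prover seat abc-iut-w5-d218 (gen 2); vacuity lane (towards the inhabitant of
`OncePuncturedTemperedGroup`). PROOF-ONLY, hypothesis-parametrised (no definition, no instance, no named
fact); continues `TemperedFibreProduct.lean`.

SETTING (continued). Besides `e : P →ₜ* Z`, `ι : ℤ →* Z` and the fibre product `Γ ≤ P × ℤ`
(`(x, n) ∈ Γ ↔ e x = ι n`), a group `F` with a homomorphism `η : F →* P` of DENSE range such that every
normal subgroup of finite index of `F` is cut out by an open normal subgroup of `P` (the profinite
completion, cf. `isProfiniteCompletion_of_eta`), and a surjection `s : F ↠ ℤ` with `e ∘ η = ι ∘ s`; of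
`(Z, ι)` we use only the separation property `hZ`: a finite-index subgroup `A ≤ ℤ` is recovered from the
closure of `ι(A)` (true for `ℤ ↪ Ẑ`). In the model: `F = F₂`, `s` = exponent sum. Results:
* `exists_openNormal_eta_mem_iff` — for Mathlib's `F̂ = completion (GrpCat.of F)`: every finite-index
  normal `N ⊴ F` is `η⁻¹` of an open normal subgroup (the hypothesis shape used below);
* `exists_inv_mul_eta_mem_and_apply_eq` — FIBREWISE DENSITY: for `(x, n) ∈ Γ` and `V ⊴ P` open normal
  there is `g ∈ F` with `η g ∈ x·V` AND `s g = n` (so the graph `{(η g, s g)}` of `F` is dense in `Γ`,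
  fibre by fibre);
* `isProfiniteCompletion_fst` — **`pr₁ : Γ → P` satisfies the FROZEN L3 predicate `IsProfiniteCompletion`**
  (dense range; an open normal subgroup `U ⊴ Γ` of finite index is `pr₁⁻¹ V` for the open normal
  `V ⊴ P` cutting out `{g | (η g, s g) ∈ U} ⊴ F`, by fibrewise density);
* `exists_apply_eq_iota` — every `ι n` is a value of `e` (so `pr₂ : Γ → ℤ` is onto,
  `TemperedFibreProduct.snd_surjective_of`).
HONEST FRAMING: classical; nothing of [SemiAnbd]/[EtTh] is asserted; no side is taken on any disputed
claim.
-/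

noncomputable section

open Topology Filter Set Function

universe u v w

namespace Literature.AnabelianGeometry.SemiGraphs

/-! ### Finite-index normal subgroups of `F` are cut out by open normal subgroups of `F̂` -/

section Eta

open CategoryTheory ProfiniteGrp ProfiniteGrp.ProfiniteCompletion
open Literature.AnabelianGeometry.EtaleTheta.DiscreteNormalizers (continuous_val exists_proj)

/-- For Mathlib's profinite completion `F̂ = completion (GrpCat.of F)` and a normal subgroup `N ⊴ F` of
finite index, the open normal subgroup `Ker(F̂ → F/N)` cuts out exactly `N`: `η g ∈ V ↔ g ∈ N`
([SemiAnbd] §6 p. 69 "the profinite completion"). [cite: MochizukiSemiAnbd2006, §6 p.69] -/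
theorem exists_openNormal_eta_mem_iff {F : Type u} [Group F] (N : Subgroup F) [N.Normal]
    [N.FiniteIndex] :
    ∃ V : OpenNormalSubgroup (completion (GrpCat.of F)), ∀ g : F, etaFn (GrpCat.of F) g ∈ V ↔ g ∈ N := by
  let N' : FiniteIndexNormalSubgroup F := { toSubgroup := N }
  obtain ⟨π, hπ⟩ := exists_proj (F := F) N'
  haveI : DiscreteTopology ((diagram (GrpCat.of F)).obj N') := ⟨rfl⟩
  have hKopen : IsOpen (π.ker : Set (completion (GrpCat.of F))) := by
    have : (π.ker : Set (completion (GrpCat.of F))) =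
        (fun x : completion (GrpCat.of F) => x.val N') ⁻¹' {x | x = 1} := by
      ext x
      simp only [SetLike.mem_coe, MonoidHom.mem_ker, Set.mem_preimage, Set.mem_setOf_eq, hπ]
      rfl
    rw [this]
    exact (isOpen_discrete _).preimage (continuous_val N')
  refine ⟨⟨⟨π.ker, hKopen⟩, inferInstance⟩, fun g => ?_⟩
  change π (etaFn (GrpCat.of F) g) = 1 ↔ g ∈ N
  rw [hπ]
  change ((QuotientGroup.mk g : F ⧸ N'.toSubgroup)) = 1 ↔ g ∈ N
  exact QuotientGroup.eq_one_iff g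

end Eta

namespace TemperedFibreProduct

variable {P : Type u} [Group P] [TopologicalSpace P] [IsTopologicalGroup P] [CompactSpace P]
  [T2Space P] [TotallyDisconnectedSpace P]
variable {Z : Type v} [Group Z] [TopologicalSpace Z]
variable (e : P →ₜ* Z) (ι : Multiplicative ℤ →* Z)
variable (Γ : Subgroup (P × Multiplicative ℤ)) (hΓ : ∀ p, p ∈ Γ ↔ e p.1 = ι p.2)
variable {F : Type w} [Group F] (η : F →* P) (hηd : DenseRange η)
  (hηN : ∀ N : Subgroup F, N.Normal → N.FiniteIndex → ∃ V : OpenNormalSubgroup P, ∀ g, η g ∈ V ↔ g ∈ N)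
  (s : F →* Multiplicative ℤ) (hs : Surjective s) (hes : ∀ g, e (η g) = ι (s g))
  (hZ : ∀ A : Subgroup (Multiplicative ℤ), A.FiniteIndex →
    ∀ k : Multiplicative ℤ, ι k ∈ closure (ι '' (A : Set (Multiplicative ℤ))) → k ∈ A)

/-! ### Fibrewise density -/

omit [T2Space P] [TotallyDisconnectedSpace P] in
include hηd hs hes hZ in
/-- **Fibrewise density of the graph of `F` in `Γ`.**  For `x ∈ P` with `e x = ι n` and an open normal
subgroup `V ⊴ P` there is `g ∈ F` with `η g ∈ x·V` and `s g = n`.  (Density of `η` gives `g₀` with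
`η g₀ ∈ x·V`; then `ι(s g₀ / n) = e(x⁻¹ η g₀)` lies in `e(V) ⊆` the closure of `ι(s(η⁻¹V))`, so by the
separation property of `ι` some `g₁ ∈ η⁻¹ V` has `s g₁ = s g₀ / n`; take `g := g₁⁻¹ g₀`.)
[cite: MochizukiSemiAnbd2006, Prop 3.6(iii) p.38] -/
theorem exists_inv_mul_eta_mem_and_apply_eq (V : OpenNormalSubgroup P) (x : P) (n : Multiplicative ℤ)
    (hx : e x = ι n) : ∃ g : F, x⁻¹ * η g ∈ V ∧ s g = n := by
  haveI : V.toSubgroup.Normal := V.isNormal'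
  -- `M := η⁻¹ V`, of finite index
  let M : Subgroup F := V.toSubgroup.comap η
  haveI hVfi : V.toSubgroup.FiniteIndex := by
    haveI : Finite (P ⧸ V.toSubgroup) := inferInstance
    exact Subgroup.finiteIndex_of_finite_quotient
  have hMfi : M.FiniteIndex := by
    refine ⟨fun h0 => ?_⟩
    have hd := Subgroup.relIndex_dvd_index_of_normal V.toSubgroup η.range
    rw [← Subgroup.index_comap] at hd
    exact hVfi.index_ne_zero (Nat.eq_zero_of_zero_dvd (h0 ▸ hd))
  have hAfi : (M.map s).FiniteIndex := by
    refine ⟨fun h0 => ?_⟩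
    have hd := Subgroup.index_map_dvd (H := M) hs
    exact hMfi.index_ne_zero (Nat.eq_zero_of_zero_dvd (h0 ▸ hd))
  -- `g₀` with `η g₀ ∈ x·V`
  have hopen : IsOpen ((fun y : P => x⁻¹ * y) ⁻¹' (V : Set P)) :=
    V.isOpen'.preimage (continuous_const.mul continuous_id)
  obtain ⟨g₀, hg₀⟩ := hηd.exists_mem_open hopen ⟨x, by simp⟩
  have hg₀' : x⁻¹ * η g₀ ∈ V := hg₀
  -- `ι (n⁻¹ * s g₀) = e (x⁻¹ * η g₀)` lies in the closure of `ι(s(M))`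
  let k : Multiplicative ℤ := n⁻¹ * s g₀
  have hk : ι k = e (x⁻¹ * η g₀) := by
    simp only [k, map_mul, map_inv, hx, hes]
  have hkcl : ι k ∈ closure (ι '' ((M.map s : Subgroup (Multiplicative ℤ)) : Set (Multiplicative ℤ))) := by
    rw [hk, mem_closure_iff]
    intro O hO hvO
    -- the open set `{y ∈ V | e y ∈ O}` contains `x⁻¹ η g₀`, hence meets `η(F)` at some `η g₂`, `g₂ ∈ M`
    have hopen' : IsOpen {y : P | y ∈ (V : Set P) ∧ e y ∈ O} :=
      V.isOpen'.inter (hO.preimage (map_continuous e))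
    obtain ⟨g₂, hg₂V, hg₂O⟩ := hηd.exists_mem_open hopen' ⟨x⁻¹ * η g₀, hg₀', hvO⟩
    refine ⟨e (η g₂), hg₂O, ⟨s g₂, ⟨g₂, hg₂V, rfl⟩, (hes g₂).symm⟩⟩
  -- separation: `k ∈ s(M)`, i.e. `k = s g₁` with `η g₁ ∈ V`
  obtain ⟨g₁, hg₁M, hg₁k⟩ := hZ (M.map s) hAfi k hkcl
  have hg₁V : η g₁ ∈ V := hg₁M
  refine ⟨g₁⁻¹ * g₀, ?_, ?_⟩
  · -- `x⁻¹ (η g₁)⁻¹ η g₀ = (x⁻¹ (η g₁)⁻¹ x) (x⁻¹ η g₀) ∈ V`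
    rw [map_mul, map_inv]
    have h1 : x⁻¹ * (η g₁)⁻¹ * x⁻¹⁻¹ ∈ V := V.isNormal'.conj_mem _ (V.toSubgroup.inv_mem hg₁V) x⁻¹
    rw [inv_inv] at h1
    have h2 : x⁻¹ * (η g₁)⁻¹ * x * (x⁻¹ * η g₀) ∈ V := V.toSubgroup.mul_mem h1 hg₀'
    simpa [mul_assoc] using h2
  · rw [map_mul, map_inv, hg₁k]
    change (n⁻¹ * s g₀)⁻¹ * s g₀ = n
    rw [mul_inv_rev, inv_inv, mul_assoc, mul_comm n (s g₀), ← mul_assoc, inv_mul_cancel, one_mul]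

omit [IsTopologicalGroup P] [CompactSpace P] [T2Space P] [TotallyDisconnectedSpace P] in
include hs hes in
/-- Every `ι n` is a value of `e` (namely at `η g` with `s g = n`); hence `pr₂ : Γ → ℤ` is onto
(`TemperedFibreProduct.snd_surjective_of`). [cite: MochizukiSemiAnbd2006, Ex 3.10 p.43] -/
theorem exists_apply_eq_iota (n : Multiplicative ℤ) : ∃ x : P, e x = ι n := by
  obtain ⟨g, rfl⟩ := hs n
  exact ⟨η g, hes g⟩

/-! ### `pr₁ : Γ → P` is the profinite completion -/

include hΓ hηd hηN hs hes hZ in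
/-- **`pr₁ : Γ → P` satisfies the L3 interface predicate `IsProfiniteCompletion`** ([SemiAnbd] §6 p. 69
"`Π_X := (Π^tp_X)^∧`"; Prop. 3.6 (iii) p. 38): `P` is profinite; the range of `pr₁` contains the dense
`η(F)`; and an open normal subgroup `U ⊴ Γ` of finite index equals `pr₁⁻¹ V` for the open normal
`V ⊴ P` that cuts out the finite-index normal subgroup `{g | (η g, s g) ∈ U} ⊴ F` — both inclusions by
FIBREWISE DENSITY (`exists_inv_mul_eta_mem_and_apply_eq`) and the openness of `U`.  Stated for any
continuous homomorphism `π₁` that agrees with the first projection.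
[cite: MochizukiSemiAnbd2006, Prop 3.6(iii) p.38] -/
theorem isProfiniteCompletion_fst (π₁ : Γ →ₜ* P) (hπ₁ : ∀ q : Γ, π₁ q = (q : P × Multiplicative ℤ).1) :
    IsProfiniteCompletion π₁ := by
  classical
  -- the graph map `j : F → Γ`, `g ↦ (η g, s g)`
  have hjmem : ∀ g : F, ((η g, s g) : P × Multiplicative ℤ) ∈ Γ := fun g => (hΓ _).mpr (hes g)
  let j : F →* Γ :=
    { toFun := fun g => ⟨(η g, s g), hjmem g⟩
      map_one' := by ext <;> simp
      map_mul' := fun a b => by ext <;> simp }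
  have hj : ∀ g, ((j g : Γ) : P × Multiplicative ℤ) = (η g, s g) := fun _ => rfl
  refine
    { compactSpace := inferInstance
      t2Space := inferInstance
      totallyDisconnectedSpace := inferInstance
      denseRange := ?_
      comap_surjective := fun U hUfi => ?_
      isOpen_comap := fun V => V.isOpen'.preimage (map_continuous π₁) }
  · -- dense range: `range π₁ ⊇ range η`
    refine hηd.mono ?_
    rintro _ ⟨g, rfl⟩
    exact ⟨j g, by rw [hπ₁, hj]⟩
  · haveI : U.toSubgroup.Normal := U.isNormal'
    haveI : U.toSubgroup.FiniteIndex := hUfi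
    -- `U' := j⁻¹ U ⊴ F`, of finite index
    let U' : Subgroup F := U.toSubgroup.comap j
    haveI hU'n : U'.Normal := Subgroup.Normal.comap inferInstance _
    have hU'fi : U'.FiniteIndex := by
      refine ⟨fun h0 => ?_⟩
      have hd := Subgroup.relIndex_dvd_index_of_normal U.toSubgroup j.range
      rw [← Subgroup.index_comap] at hd
      exact hUfi.index_ne_zero (Nat.eq_zero_of_zero_dvd (h0 ▸ hd))
    obtain ⟨V, hV⟩ := hηN U' hU'n hU'fi
    -- a slice `N_W ⊆ U`
    obtain ⟨W, NW, -, hNW, hNWU⟩ :=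
      exists_openNormal_le_of_mem_nhds Γ (U.toOpenSubgroup.mem_nhds_one)
    haveI : V.toSubgroup.Normal := V.isNormal'
    haveI : W.toSubgroup.Normal := W.isNormal'
    -- the open normal subgroup `V ∩ W`
    let VW : OpenNormalSubgroup P := ⟨⟨V.toSubgroup ⊓ W.toSubgroup, V.isOpen'.inter W.isOpen'⟩,
      inferInstance⟩
    refine ⟨V, ?_⟩
    ext q
    obtain ⟨⟨x, n⟩, hq⟩ := q
    have hxn : e x = ι n := (hΓ _).mp hq
    -- fibrewise density inside `V ∩ W`: `g` with `x⁻¹ η g ∈ V ∩ W`, `s g = n`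
    obtain ⟨g, hgVW, hgn⟩ := exists_inv_mul_eta_mem_and_apply_eq e ι η hηd s hs hes hZ VW x n hxn
    have hgV : x⁻¹ * η g ∈ V := (Subgroup.mem_inf.mp hgVW).1
    have hgW : x⁻¹ * η g ∈ W := (Subgroup.mem_inf.mp hgVW).2
    -- the element `q⁻¹ * j g = (x⁻¹ η g, 1)` lies in `N_W ⊆ U`
    have hdiff : (⟨(x, n), hq⟩ : Γ)⁻¹ * j g ∈ U := by
      apply hNWU
      apply (hNW _).mpr
      refine ⟨?_, ?_⟩
      · change x⁻¹ * η g ∈ W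
        exact hgW
      · change n⁻¹ * s g = 1
        rw [hgn, inv_mul_cancel]
    constructor
    · -- `q ∈ U ⇒ x ∈ V`: `j g ∈ U`, so `g ∈ U'`, so `η g ∈ V`, so `x = η g (x⁻¹ η g)⁻¹ ∈ V`
      intro hqU
      have hjg : j g ∈ U := by
        have := U.toSubgroup.mul_mem hqU hdiff
        rwa [mul_inv_cancel_left] at this
      have hgU' : g ∈ U' := hjg
      have hηgV : η g ∈ V := (hV g).mpr hgU'
      change π₁ ⟨(x, n), hq⟩ ∈ V
      rw [hπ₁]
      change x ∈ V
      have : x = η g * (x⁻¹ * η g)⁻¹ := by group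
      rw [this]
      exact V.toSubgroup.mul_mem hηgV (V.toSubgroup.inv_mem hgV)
    · -- `x ∈ V ⇒ q ∈ U`: `η g = x (x⁻¹ η g) ∈ V`, so `g ∈ U'`, `j g ∈ U`, `q = j g (q⁻¹ j g)⁻¹ ∈ U`
      intro hxV
      have hxV' : x ∈ V := by
        have := hxV
        change π₁ ⟨(x, n), hq⟩ ∈ V at this
        rw [hπ₁] at this
        exact this
      have hηgV : η g ∈ V := by
        have := V.toSubgroup.mul_mem hxV' hgV
        rwa [mul_inv_cancel_left] at this
      have hgU' : g ∈ U' := (hV g).mp hηgV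
      have hjg : j g ∈ U := hgU'
      have := U.toSubgroup.mul_mem hjg (U.toSubgroup.inv_mem hdiff)
      rwa [mul_inv_rev, inv_inv, mul_inv_cancel_left] at this

end TemperedFibreProduct

end Literature.AnabelianGeometry.SemiGraphs

end
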